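import Mathlib.Analysis.SpecialFunctions.BinaryEntropy
import Literature.Probability.RandomPlanarGeometry.LoewnerCotArgExit
import Literature.Probability.RandomPlanarGeometry.SLEKappaRhoSchrammObservable
import Literature.Probability.RandomPlanarGeometry.JordanIndex
import Literature.Probability.RandomPlanarGeometry.SelfAvoidingWalk
import Literature.Probability.LatticeModels.SRWKilledWalkFunctionals
import HarnessLib

/-!
# Objects of the line `room-entropy-wright-fisher` for the crux `SubseqIdentification`
(stmt-CriticalPhenomena-0783; lead prover, crux protocol; skeleton
`Summits/CriticalPhenomena/SAWScalingLimit/Cruxes/SubseqIdentification/Lines/room-entropy-wright-fisher.lean`)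

The crux asks that every probability subsequential weak limit of the critical `δℤ²` SAW laws of a
Dobrushin domain `(D; a, b)` along meshes `s n → 0⁺` be the chordal SLE(8/3) law of `D`.  The line
identifies such limits by ONE interior, dimension-0, orientation-free observable: the ROOM of a
point (diagonal killed Green function of an independent simple random walk on the same graph,
killed on the polymer), whose continuum avatar is the log-conformal-radius loss `log ψ_t(w)`
(`Loewner.derivRatio`), paired with Schramm's observable `S_t(w)` (`Loewner.schrammObs`); the
κ = 8/3 prediction for the expected loss still to come is the entropy-shaped profile
`Λ(θ) = 3·H(sin²(θ/2))`.  This file only DEFINES the objects the line's registered stubs speak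
about, verbatim as in the skeleton (so that the stub files under `Theorems/` and the line's final
file share one vocabulary) — no statement of the line is asserted here:

* continuum: `roomProfile`, `roomObs`, `roomStop`, `roomObsStopped`;
* lattice: `dirs`, `rotL`, `rotR`, `slitGraph`, `roomAt`, `verts`, `IsSideDart`, `sideDartSum`,
  `arcExitSum`, `sideAngle`, `condRoom`.

Sources: the idea card `Cruxes/SubseqIdentification/Ideas/room-entropy-wright-fisher.md` and line
card `Lines/room-entropy-wright-fisher.md`; G. Lawler, O. Schramm, W. Werner, *On the scaling
limit of planar self-avoiding walk* (2004) §2 (side hitting of the SAW by Brownian motion);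
M. Kozdron, G. Lawler, *Estimates of random walk exit probabilities…* (2005) §2.3 (killed Green
functions `G_A`).  Deliberately NOT here: the three stub statements (`RoomLawSlit`,
`RoomMartingaleLimit`, `RoomEntropyCharacterisesSLE`), the sanity statements `RoomProfileODE`,
`RoomEntropyDrift`, and any theorem about them — they live in the stub files and the line's final
file.
-/

noncomputable section

open MeasureTheory Filter Topology Set
open scoped NNReal ENNReal Classical BigOperators
open Literature.Probability.LatticeModels
open Literature.Probability.RandomPlanarGeometry

namespace Summit.CriticalPhenomena.SAWScalingLimit.Theorems.SubseqIdentification.RoomEntropy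

/-! ## Continuum vocabulary (statements only) -/

/-- The κ = 8/3 **room profile** `Λ(θ) = 3·H(sin²(θ/2))`, `H` = binary entropy in nats
(`Real.binEntropy`): expected log-conformal-radius loss of chordal SLE(8/3) seen from a point at
conformal angle `θ`; `Λ(0) = Λ(π) = 0`, `Λ(π/2) = 3 log 2`, `Λ(π − θ) = Λ(θ)`. -/
def roomProfile (θ : ℝ) : ℝ :=
  3 * Real.binEntropy (Real.sin (θ / 2) ^ 2)

/-- The **room–entropy observable** along the centred Loewner flow of a driving function `W`
seen from `w ∈ ℍ`: `N_t(w) = log ψ_t(w) + 3·H(S_t(w))`, `ψ_t` = Rohde–Schramm's ratio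
`Loewner.derivRatio` (`log ψ_t` = loss of log conformal radius of `ℍ ∖ K_t` at `w`), `S_t` =
Schramm's observable `Loewner.schrammObs = (1 + cos arg z_t)/2`; since `H(p) = H(1 − p)`,
`3·H(S_t) = Λ(arg z_t)`. Junk after the swallowing time (never reached below). -/
def roomObs (W : ℝ≥0 → ℝ) (w : ℂ) (t : ℝ≥0) : ℝ :=
  Real.log (Loewner.derivRatio W w t) + 3 * Real.binEntropy (Loewner.schrammObs W w t)

/-- The **room stop** `τ^{w,m}`: the first time `Im z_t(w) ≤ Im w/(m+1)`, capped at `m + 1`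
(the union with `{m+1}` makes the infimum a minimum; before `τ^{w,m}` one has
`0 ≤ log ψ_t ≤ log(m+1) + 2(m+1)³/(Im w)²`, so the stopped observable is bounded, and
`dist(w, K_t ∪ ℝ) ≥ Im w/(2ψ_t)` by Koebe, so the hull stays a definite distance from `w`). -/
def roomStop (W : ℝ≥0 → ℝ) (w : ℂ) (m : ℕ) : ℝ≥0 :=
  sInf ({t : ℝ≥0 | (Loewner.centredMap W t w).im ≤ w.im / ((m : ℝ) + 1)} ∪ {(m : ℝ≥0) + 1})

/-- The stopped room–entropy observable `N^{w,m}_t = N_{t ∧ τ^{w,m}}(w)`. -/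
def roomObsStopped (W : ℝ≥0 → ℝ) (w : ℂ) (m : ℕ) (t : ℝ≥0) : ℝ :=
  roomObs W w (min t (roomStop W w m))

/-! ## Lattice vocabulary (statements only): slit graphs, rooms, side darts -/

/-- The four unit steps of `ℤ²`. -/
def dirs : Finset (Site 2) := {![1, 0], ![0, 1], ![-1, 0], ![0, -1]}

/-- Anticlockwise quarter turn of `ℤ²`. -/
def rotL (d : Site 2) : Site 2 := ![-(d 1), d 0]

/-- Clockwise quarter turn of `ℤ²`. -/
def rotR (d : Site 2) : Site 2 := ![d 1, -(d 0)]

/-- The **slit graph** `Ω_δ ∖ S`: the discrete domain graph with the vertices of `S` isolated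
(the pattern of `SRW.exitAfterAvoiding_of_adj_iff`). The simple random walk run along its edges
is killed at its first step onto `S`, out of `Ω_δ`, or along a deleted boundary edge. -/
def slitGraph (Ω : Set ℂ) (δ : ℝ) (S : Set (Site 2)) : SimpleGraph (Site 2) :=
  SimpleGraph.fromRel fun x y => (discreteDomainGraph Ω δ).Adj x y ∧ x ∉ S ∧ y ∉ S

/-- The **room** of the site `z` in `Ω_δ ∖ S`: the diagonal killed Green function
`G_{Ω_δ∖S}(z, z)` = expected number of visits to `z` (time `0` included) of the simple random
walk from `z` before it is killed (`SRW.killedGreen`). -/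
def roomAt (Ω : Set ℂ) (δ : ℝ) (S : Set (Site 2)) (z : Site 2) : ℝ :=
  SRW.killedGreen (slitGraph Ω δ S) z z

/-- The vertex set of a walk. -/
def verts {G : SimpleGraph (Site 2)} {u w : Site 2} (η : G.Walk u w) : Set (Site 2) :=
  {v | v ∈ η.support}

/-- **Side darts of a lattice path.** For `0 < k < |η|`, incoming step `i = η_k − η_{k−1}` and
outgoing step `o = η_{k+1} − η_k`, the free neighbour `η_k + d ∉ η` lies on the `ρ`-side of `η`
at `η_k` (`ρ = rotL`: left of the direction of travel; `ρ = rotR`: right) iff either the path goes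
straight (`o = i`) and `d = ρ i`, or the path turns AWAY from the `ρ`-side (`o = −ρ i`), in which
case both free neighbours are on the `ρ`-side. Darts at the two endpoints are not side darts
(their harmonic measure from an interior point vanishes in the limit: Beurling at the tip, the
closing gap `δ·a_δ → a ∈ ∂D` at the start). [folklore] -/
def IsSideDart {G : SimpleGraph (Site 2)} {u w : Site 2} (ρ : Site 2 → Site 2) (η : G.Walk u w)
    (k : ℕ) (d : Site 2) : Prop :=
  0 < k ∧ k < η.length ∧ η.getVert k + d ∉ η.support ∧
    ((η.getVert (k + 1) - η.getVert k = η.getVert k - η.getVert (k - 1) ∧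
        d = ρ (η.getVert k - η.getVert (k - 1))) ∨
      η.getVert (k + 1) - η.getVert k = -ρ (η.getVert k - η.getVert (k - 1)))

/-- `4 ×` the harmonic measure, from `z` in the slit graph `Ω_δ ∖ η`, of the `ρ`-side darts of `η`:
`Σ_{side darts (η_k + d → η_k)} G_{Ω_δ∖η}(z, η_k + d)` (last-exit decomposition: the walk is killed
through the dart `(q → q')` with probability `G(z, q)/4`). -/
def sideDartSum (Ω : Set ℂ) (δ : ℝ) {u w : Site 2} (ρ : Site 2 → Site 2)
    (η : (discreteDomainGraph Ω δ).Walk u w) (z : Site 2) : ℝ :=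
  ∑ k ∈ Finset.range η.length, ∑ d ∈ dirs,
    if IsSideDart ρ η k d then SRW.killedGreen (slitGraph Ω δ (verts η)) z (η.getVert k + d) else 0

/-- `4 ×` the harmonic measure, from `z` in `Ω_δ ∖ η`, of the exits of `Ω_δ` through the discrete
boundary arc `1` (`discreteArc`, Smirnov's closest-arc convention; `D.arc 1` runs from `b` to `a`):
`Σ_{q ∈ arc₁, q ∉ η} #{non-edges of Ω_δ at q} · G_{Ω_δ∖η}(z, q)`. -/
def arcExitSum (D : DobrushinDomain) (δ : ℝ) {u w : Site 2}
    (η : (discreteDomainGraph D.carrier δ).Walk u w) (z : Site 2) : ℝ :=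
  ∑' q : Site 2,
    if q ∈ discreteArc D.carrier δ (D.arc 1) ∧ q ∉ η.support then
      (∑ d ∈ dirs, if (discreteDomainGraph D.carrier δ).Adj q (q + d) then (0 : ℝ) else 1) *
        SRW.killedGreen (slitGraph D.carrier δ (verts η)) z q
    else 0

/-- The **lattice side angle** `θ*_δ(η, z) := π ×` harmonic measure from `z`, in `Ω_δ ∖ η`, of
[exits through `arc 1`] + [side darts of `η` on the `arc 1` side]. Which side of `η` faces
`arc 1` is decided by the ORIENTATION of the boundary loop (`JordanDomain.index = +1`:
anticlockwise, `arc 1` side = left of the direction of travel `a → b`; `−1`: right). In the limit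
`θ*` is `arg z_t` or `π − arg z_t` of the centred flow, and the profile `Λ` does not distinguish
them. -/
def sideAngle (D : DobrushinDomain) (δ : ℝ) {u w : Site 2}
    (η : (discreteDomainGraph D.carrier δ).Walk u w) (z : Site 2) (zc : ℂ) : ℝ :=
  Real.pi / 4 *
    (arcExitSum D δ η z +
      sideDartSum D.carrier δ (if D.toJordanDomain.index zc = 1 then rotL else rotR) η z)

/-- The **expected terminal room given the past**: `E_δ[G_{Ω_δ∖γ}(z,z) ∣ γ begins with η]` under
the critical SAW law from `a` to `b` (set integral over the cylinder of `η` divided by its mass;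
by the domain-Markov property of `x_c^{|γ|}` this is the expected-terminal-room one-point function
of the slit domain `(Ω_δ ∖ η; tip, b)`). Junk `0/0 = 0` on cylinders of mass `0` (never met on
pasts of sampled walks). -/
def condRoom (Ω : Set ℂ) (δ : ℝ) (a b z : Site 2) {w : Site 2}
    (η : (discreteDomainGraph Ω δ).Walk a w) : ℝ :=
  (∫ γ in {γ : SAW.DomainSAW Ω δ a b | ∃ hw : w ∈ γ.walk.support, γ.walk.takeUntil w hw = η},
      roomAt Ω δ (verts γ.walk) z ∂(SAW.law Ω δ a b)) /
    ((SAW.law Ω δ a b)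
      {γ : SAW.DomainSAW Ω δ a b | ∃ hw : w ∈ γ.walk.support, γ.walk.takeUntil w hw = η}).toReal


/-! ## Trivial API (sanity of the vocabulary) -/

/-- The room profile vanishes at `θ = 0` (no loss when the point sees only one side).
[folklore] -/
theorem roomProfile_zero : roomProfile 0 = 0 := by
  simp [roomProfile]

/-- The room profile is symmetric under `θ ↦ -θ` (it is a function of `sin²(θ/2)`). [folklore] -/
theorem roomProfile_neg (θ : ℝ) : roomProfile (-θ) = roomProfile θ := by
  simp [roomProfile, neg_div, Real.sin_neg]

end Summit.CriticalPhenomena.SAWScalingLimit.Theorems.SubseqIdentification.RoomEntropy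

end
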